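import Summits.HodgeConjecture.CorCM.MumfordTateRankEqHodgeLieRankAddOne
import Literature.AlgebraicGeometry.Motives.HodgeLieOfAbelianVarietyPower
import Literature.AlgebraicGeometry.Pohlmann1968.SimpleCMAbelianVarietyPowersDivisorGenerated
import HarnessLib

/-!
# The Mumford–Tate rank of a power: `dim MT(H¹(X)) = dim MT(H¹(B))` for every complex abelian variety `X ∼ B^{m+1}`

COR-CM (cell `pub-hodgecm2`, seat `b27` gen 42, count-neutral Mumford–Tate-rank ladder; theorems only, no definition, no named
fact; UNCONDITIONAL — nothing here uses or asserts HC_CM).  The ladder's indexing invariant `t = dim MT(H¹X)` is an invariant of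
the simple factor for isotypic `X`: `Hg(Bⁿ) = Hg(B)` acting diagonally (Moonen–Zarhin 1999 §1), in the tree as
`dim Lie Hg(H¹(⨁_{Fin(a+1)} B)) = dim Lie Hg(H¹B)` (`Motives/HodgeLieOfAbelianVarietyPower`, from the diagonal
`𝔥(H^{⊕ι}) = Δ𝔥(H)` of `Motives/HodgeLieDiagonal`) and `dim MT = dim Lie Hg + 1` (`CorCM/MumfordTateRankEqHodgeLieRankAddOne`).

* **`mtRank_hodge_one_eq_of_isIsogenous_biproduct_const`** — `X ∼ ⨁_{Fin (m+1)} B`, `0 < dim B` ⟹ `dim MT(H¹X) = dim MT(H¹B)`;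
* **`mtRank_hodge_one_eq_of_isIsogenous_powSucc`** — the same for `X ∼ B^{m+1}` (`AbelianVariety.powSucc`).
Used by `CorCM/MumfordTateRankSevenTypeThreeFactor` (the simple factor of the type-III position has `t = 7`).

## References

* [MoonenZarhin1999LowDim] B. Moonen, Yu. Zarhin, *Hodge classes on abelian varieties of low dimension*, Math. Ann.
  315 (1999), §1 («for `n ≥ 1` we can identify `Hg(Xⁿ)` with `Hg(X)`, acting diagonally»).
* [Deligne1982HodgeCycles] P. Deligne, *Hodge cycles on abelian varieties*, LNM 900 (1982), I §3.1 and Prop. 3.4.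
-/

noncomputable section

open scoped TensorProduct
open CategoryTheory CategoryTheory.Limits Module

namespace Summit.HodgeConjecture.CorCM

open Literature.AlgebraicGeometry.Motives
open Literature.AlgebraicGeometry.Motives.AbelianVariety
open Literature.AlgebraicGeometry.Motives.HodgeStructure
open Literature.AlgebraicGeometry.HodgeTheory
open Literature.AlgebraicGeometry.Pohlmann1968 (isIsogenous_powSucc_biproduct)

variable [HodgeTensorFacts.{0, 0}] {X : AbelianVariety ℂ} {n : ℕ}

/-- **`dim MT(H¹X) = dim MT(H¹B)` for every complex abelian variety `X ∼ ⨁_{Fin (m+1)} B` with `0 < dim B`** —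
`Hg(Bⁿ) = Hg(B)` acting diagonally (Moonen–Zarhin 1999 §1): `dim Lie Hg(H¹X) = dim Lie Hg(H¹B)`
(`finrank_hodgeLie_hodge_one_eq_of_isIsogenous_biproduct_const`, the diagonal `Δ 𝔥(H) ⊆ 𝔥(H^{⊕ι})` of
`Motives/HodgeLieDiagonal` transported along Künneth), and `dim MT = dim Lie Hg + 1` on both sides.
[cite: MoonenZarhin1999LowDim, §1] [cite: Deligne1982HodgeCycles, I §3.1 and Prop. 3.4] -/
theorem mtRank_hodge_one_eq_of_isIsogenous_biproduct_const (hX : IsSmoothProjective n X.X) {B : AbelianVariety ℂ}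
    {k : ℕ} (hB : IsSmoothProjective k B.X) (hB0 : 0 < B.dim) {m : ℕ}
    (hXB : IsIsogenous X (⨁ fun _ : Fin (m + 1) => B)) :
    haveI := BettiUniverse.finite hX 1
    haveI := BettiUniverse.finite hB 1
    (BettiUniverse.hodge exists_isReal_hodgeModel_holds hX 1).mtRank =
      (BettiUniverse.hodge exists_isReal_hodgeModel_holds hB 1).mtRank := by
  haveI := BettiUniverse.finite hX 1
  haveI := BettiUniverse.finite hB 1
  have h0 : 0 < X.dim := by
    obtain ⟨f, hf⟩ := hXB
    rw [dim_eq_of_isIsogeny hf, AndreRiemann.dim_biproduct_const]; positivity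
  rw [mtRank_hodge_one_eq_finrank_hodgeLie_add_one hX h0, mtRank_hodge_one_eq_finrank_hodgeLie_add_one hB hB0,
    AbelianVariety.finrank_hodgeLie_hodge_one_eq_of_isIsogenous_biproduct_const hB hX hXB]

/-- **`dim MT(H¹X) = dim MT(H¹B)` for `X ∼ B^{m+1}`** (`AbelianVariety.powSucc`; `B^{m+1} ≅ ⨁_{Fin (m+1)} B`,
`isIsogenous_powSucc_biproduct`). [cite: MoonenZarhin1999LowDim, §1] -/
theorem mtRank_hodge_one_eq_of_isIsogenous_powSucc (hX : IsSmoothProjective n X.X) {B : AbelianVariety ℂ}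
    {k : ℕ} (hB : IsSmoothProjective k B.X) (hB0 : 0 < B.dim) {m : ℕ} (hXB : IsIsogenous X (B.powSucc m)) :
    haveI := BettiUniverse.finite hX 1
    haveI := BettiUniverse.finite hB 1
    (BettiUniverse.hodge exists_isReal_hodgeModel_holds hX 1).mtRank =
      (BettiUniverse.hodge exists_isReal_hodgeModel_holds hB 1).mtRank :=
  mtRank_hodge_one_eq_of_isIsogenous_biproduct_const hX hB hB0 (hXB.trans (isIsogenous_powSucc_biproduct B m))

end Summit.HodgeConjecture.CorCM

end
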